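import Literature.Geometry.Kaehler.ComplexTorusMinimalClassesUnimodular
import Mathlib.Data.ZMod.QuotientGroup
import HarnessLib

/-!
# The position of the Lefschetz image `γ_j ∧ Hˡ(X, ℤ)` against the `θ`-kernel:
# `[H^{2j+l}(X, ℤ) : γ_j ∧ Hˡ(X, ℤ) + K_θ] = (j+1)·d_{j+1}/d₁`, in particular `[H^{2g−2}(X, ℤ) : γ_{g−2} ∧ H²(X, ℤ) + K_θ] = (g−1)·d_{g−1}/d₁`

Layer `Literature/Geometry/Kaehler`, namespace `Literature.Geometry.Kaehler.ComplexTorus`; lane `lit-hodgefound` (Track 2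
foundations library), seat p09, generation 41, row g41-#10 (successor-menu item (b) of gen 40). THEOREMS ONLY (0 definitions); no named fact,
net debt 0. Sequel of g41-#9 `ComplexTorusMinimalClassesUnimodular` (the minimal classes `γ_q = θ^{∧q}/(q!·d₁⋯d_q)` pair `H^{2g−2q}(X, ℤ)`
onto `ℤ`; the value group of `θ^{∧q}` is `(q!·d₁⋯d_q)ℤ`) and g36-#1 `ComplexTorusMinimalClasses`.

Sources (the statements being made precise over `ℤ`):

* Lange 2023 §5.4.1 Thm. 5.4.1 and (5.22) (PDF p. 275: the Lefschetz decomposition `H^k = ⊕ L^r P^{k−2r}`, hard Lefschetz; over `ℚ`, not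
  over `ℤ`), §2.5.3 Thm. 2.5.16 / Cor. 2.5.17 (PDF p. 135: `θ^{∧q}` on a symplectic basis, the content `q!·d₁⋯d_q`), §6.2.4 (PDF p. 310
  L9–L13: Poincaré duality over `ℤ`), §1.5.1 (PDF p. 51: types `d₁ ∣ ⋯ ∣ d_g`);
* Voisin 2002 §6.2.3 Thm. 6.25 (PDF p. 125: Lefschetz decomposition) and §7.1.2 (PDF p. 134 L31: `L` acts on integral cohomology);
* Benoist–Debarre 2023 §1 (p. 3): the minimal classes `θ^c/c!` (principal case).

THE RESULT. Fix a polarised torus `X = E/Φ(ℤ^ι)` of type `(d₁, …, d_g)`, `θ = ofRealForm η`, the minimal classes `γ_j`, `γ_{j+1}`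
(`θ^{∧j} = (j!·d₁⋯d_j)·γ_j`, `θ^{∧(j+1)} = ((j+1)!·d₁⋯d_{j+1})·γ_{j+1}`), an orientation `e`, and the `θ`-FUNCTIONAL `φ = ⟨θ, ·⟩_e` on
`H^{2j+l}(X, ℂ)` (`2 + 2j + l = 2g`) with kernel `K_θ` (the classes annihilated by cup product with the polarisation — over `ℚ` the sum of the
non-top Lefschetz pieces). Then:

* §1 `θ ∧ γ_j = (j+1)·d_{j+1}·γ_{j+1}` (the quotient of consecutive contents), hence `⟨θ, γ_j ∧ ω⟩ = (j+1)·d_{j+1}·⟨γ_{j+1}, ω⟩` for every `ω`;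
* §2 the VALUE GROUPS: `φ(H^{2j+l}(X, ℤ)) = d₁ℤ` (`θ = d₁γ₁`, `γ₁` unimodular) and `φ(γ_j ∧ Hˡ(X, ℤ)) = (j+1)·d_{j+1}·ℤ` (`γ_{j+1}` unimodular);
* §3 the INDEX: `H/(S + K_θ ∩ H) ≅ φ(H)/φ(S)`, so
  **`[H^{2j+l}(X, ℤ) : γ_j ∧ Hˡ(X, ℤ) + K_θ] = (j+1)·d_{j+1}/d₁`**; for `g = j + 2`, `l = 2`:
  **`[H^{2g−2}(X, ℤ) : γ_{g−2} ∧ H²(X, ℤ) + K_θ] = (g−1)·d_{g−1}/d₁`** (principal polarisation: `g − 1`; compare the full index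
  `[H^{2g−2} : γ_{g−2} ∧ H²] = (g−1)·∏((d_{g−1}/d_i)(d_g/d_i))^{…}` of g40-#6 — the factor `(g−1)·d_{g−1}/d₁` is the part of the cokernel seen by
  `θ`, the rest lies inside `K_θ`).

## Contents (theorems only)

* §0 (private) `[aℤ : bℤ] = a/b` inside `ℂ`; `θ^{∧1} = θ`; the quotient of consecutive contents; integrality of the divided classes.
* §1 `IsPolarizationType.ofRealForm_wedge_eq_smul_of_eq_content_smul`, `IsPolarizationType.poincarePairing_ofRealForm_wedge_eq_mul`.
* §2 `IsPolarizationType.map_poincarePairing_ofRealForm_eq_zmultiples` (`φ(H) = d₁ℤ`),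
  `IsPolarizationType.map_map_wedge_poincarePairing_ofRealForm_eq_zmultiples` (`φ(γ_j ∧ Hˡℤ) = (j+1)d_{j+1}ℤ`).
* §3 `IsPolarizationType.relIndex_map_wedge_sup_ker_poincarePairing_ofRealForm` (the index), the `IsSymplecticEnum` form and the `g = j + 2`,
  `l = 2` headline `IsSymplecticEnum.relIndex_map_wedge_two_sup_ker_eq`, with its existence form.

## References

* [cite: Lange2023AbelianVarietiesComplex, §5.4.1 Thm. 5.4.1 and (5.22) (PDF p. 275); §2.5.3 Thm. 2.5.16 and Cor. 2.5.17 (PDF p. 135); §6.2.4 (PDF p. 310 L9–L13); §1.5.1 (PDF p. 51)]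
* [cite: VoisinHodgeI2002, §6.2.3 Thm. 6.25 (PDF p. 125); §7.1.2 (PDF p. 134 L31)]
* [cite: BenoistDebarre2023SmoothSubvarietiesJacobians, §1 (p. 3)]
-/

noncomputable section

open Module Function
open Literature.LinearAlgebra.Alternating

namespace Literature.Geometry.Kaehler.ComplexTorus

/-! ## §0 Preliminaries (private) -/

section Prelim

/-- `[aℤ : bℤ] = a/b` for the cyclic subgroups of `ℂ` generated by naturals `b ∣ a`, `b ≠ 0`. [folklore] -/
private theorem relIndex_zmultiples_natCast₅₁ {a b : ℕ} (hb : b ≠ 0) (hba : b ∣ a) :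
    (AddSubgroup.zmultiples (a : ℂ)).relIndex (AddSubgroup.zmultiples (b : ℂ)) = a / b := by
  obtain ⟨c, rfl⟩ := hba
  rw [Nat.mul_div_cancel_left c (Nat.pos_of_ne_zero hb)]
  have hb' : (b : ℂ) ≠ 0 := Nat.cast_ne_zero.2 hb
  set f : ℤ →+ ℂ := zmultiplesHom ℂ (b : ℂ) with hf
  have hrange : (⊤ : AddSubgroup ℤ).map f = AddSubgroup.zmultiples (b : ℂ) := by
    rw [← AddMonoidHom.range_eq_map, hf, AddSubgroup.range_zmultiplesHom]
  have hcomap : (AddSubgroup.zmultiples ((b * c : ℕ) : ℂ)).comap f = AddSubgroup.zmultiples (c : ℤ) := by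
    ext k
    rw [AddSubgroup.mem_comap, AddSubgroup.mem_zmultiples_iff, AddSubgroup.mem_zmultiples_iff, hf, zmultiplesHom_apply]
    constructor
    · rintro ⟨m, hm⟩
      refine ⟨m, ?_⟩
      have h1 : ((m * c : ℤ) : ℂ) * b = ((k : ℤ) : ℂ) * b := by
        rw [zsmul_eq_mul, zsmul_eq_mul] at hm
        push_cast at hm ⊢
        linear_combination hm
      rw [smul_eq_mul]
      exact_mod_cast mul_right_cancel₀ hb' h1
    · rintro ⟨m, rfl⟩
      refine ⟨m, ?_⟩
      rw [zsmul_eq_mul, zsmul_eq_mul, smul_eq_mul]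
      push_cast
      ring
  have h := AddSubgroup.relIndex_comap (AddSubgroup.zmultiples ((b * c : ℕ) : ℂ)) f ⊤
  rw [hcomap, hrange, AddSubgroup.relIndex_top_right, Int.index_zmultiples] at h
  rw [← h]
  simp

variable {E : Type*} [NormedAddCommGroup E] [NormedSpace ℂ E]

/-- `θ^{∧1} = θ`. [folklore] -/
private theorem wedgePow_one_eq_self₅₁ (θ : E [⋀^Fin 2]→L[ℝ] ℂ) : wedgePow θ 1 = θ := by
  rw [wedgePow_one, Literature.Analysis.Complex.oneForm₀, ContinuousAlternatingMap.constOfIsEmpty_one_wedge]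
  ext v
  rfl

/-- The quotient of consecutive contents: `(j+1)!·d₁⋯d_{j+1} = (j!·d₁⋯d_j)·((j+1)·d_{j+1})`. [cite: Lange2023AbelianVarietiesComplex, §2.5.3 Thm. 2.5.16 (PDF p. 135)] -/
private theorem content_succ₅₁ {g j : ℕ} (d : Fin g → ℕ) (hle : j ≤ g) (hle₁ : j + 1 ≤ g) :
    (j + 1).factorial * ∏ i : Fin (j + 1), d (Fin.castLE hle₁ i) =
      (j.factorial * ∏ i : Fin j, d (Fin.castLE hle i)) * ((j + 1) * d (Fin.castLE hle₁ (Fin.last j))) := by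
  rw [Fin.prod_univ_castSucc, Nat.factorial_succ]
  have hcs : ∏ i : Fin j, d (Fin.castLE hle₁ i.castSucc) = ∏ i : Fin j, d (Fin.castLE hle i) :=
    Finset.prod_congr rfl fun i _ ↦ congrArg d (Fin.ext rfl)
  rw [hcs]
  ring

end Prelim

section Core

variable {ι : Type*} [Fintype ι] [DecidableEq ι] {E : Type*} [NormedAddCommGroup E] [NormedSpace ℂ E]
  (Φ : (ι → ℝ) ≃L[ℝ] E) {g n : ℕ} {η : E [⋀^Fin 2]→L[ℝ] ℝ} {d : Fin g → ℕ}

/-- The content `q!·d₁⋯d_q` of a Riemann form of type `d` is non-zero. [cite: Lange2023AbelianVarietiesComplex, §1.5.1 (PDF pp. 51–52)] -/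
private theorem content_ne_zero₅₁ {Φ : (ι → ℝ) ≃L[ℝ] E} (hd : IsPolarizationType Φ η d) (hη : IsRiemannForm Φ η) {q : ℕ} (hq : q ≤ g) :
    ((q.factorial * ∏ i : Fin q, d (Fin.castLE hq i) : ℕ) : ℂ) ≠ 0 :=
  Nat.cast_ne_zero.2 (Nat.mul_ne_zero (Nat.factorial_ne_zero q)
    (Finset.prod_ne_zero_iff.2 fun _ _ ↦ (hd.pos hη _).ne'))

/-- The divided class is integral (any presentation). [cite: Lange2023AbelianVarietiesComplex, §2.5.3 Thm. 2.5.16 (PDF p. 135)] -/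
private theorem mem_integralForms_of_wedgePow_eq_content_smul₅₁ {Φ : (ι → ℝ) ≃L[ℝ] E} (hd : IsPolarizationType Φ η d)
    (hη : IsRiemannForm Φ η) {q : ℕ} (hq : q ≤ g) {γ : E [⋀^Fin (2 * q)]→L[ℝ] ℂ}
    (hγ : wedgePow (ofRealForm η) q = ((q.factorial * ∏ i, d (Fin.castLE hq i) : ℕ) : ℂ) • γ) : γ ∈ integralForms Φ (2 * q) := by
  obtain ⟨γ', hγ'Z, hγ'⟩ := hd.exists_mem_integralForms_wedgePow_eq_content_smul hq
  rwa [smul_right_injective (E [⋀^Fin (2 * q)]→L[ℝ] ℂ) (content_ne_zero₅₁ hd hη hq) (hγ.symm.trans hγ')]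

/-! ## §1 `θ ∧ γ_j = (j+1)·d_{j+1}·γ_{j+1}` and `⟨θ, γ_j ∧ ω⟩ = (j+1)·d_{j+1}·⟨γ_{j+1}, ω⟩` -/

/-- **`θ ∧ γ_j = (j+1)·d_{j+1}·γ_{j+1}`** (reindexed `2 + 2j = 2(j+1)`): `θ ∧ θ^{∧j} = θ^{∧(j+1)}`, and the contents satisfy
`(j+1)!·d₁⋯d_{j+1} = (j!·d₁⋯d_j)·((j+1)·d_{j+1})`. [cite: Lange2023AbelianVarietiesComplex, §2.5.3 Thm. 2.5.16 and Cor. 2.5.17 (PDF p. 135)] [cite: BenoistDebarre2023SmoothSubvarietiesJacobians, §1 (p. 3)] -/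
theorem IsPolarizationType.ofRealForm_wedge_eq_smul_of_eq_content_smul {Φ : (ι → ℝ) ≃L[ℝ] E} (hd : IsPolarizationType Φ η d)
    (hη : IsRiemannForm Φ η) {j : ℕ} (hle : j ≤ g) (hle₁ : j + 1 ≤ g) {γ : E [⋀^Fin (2 * j)]→L[ℝ] ℂ} {m : E [⋀^Fin (2 * (j + 1))]→L[ℝ] ℂ}
    (hγ : wedgePow (ofRealForm η) j = ((j.factorial * ∏ i : Fin j, d (Fin.castLE hle i) : ℕ) : ℂ) • γ)
    (hm : wedgePow (ofRealForm η) (j + 1) = (((j + 1).factorial * ∏ i : Fin (j + 1), d (Fin.castLE hle₁ i) : ℕ) : ℂ) • m) :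
    ((ofRealForm η).wedge γ).domDomCongr (finCongr (Nat.add_comm 2 (2 * j))) = (((j + 1) * d (Fin.castLE hle₁ (Fin.last j)) : ℕ) : ℂ) • m := by
  have hC : (((j + 1).factorial * ∏ i : Fin (j + 1), d (Fin.castLE hle₁ i) : ℕ) : ℂ) =
      ((j.factorial * ∏ i : Fin j, d (Fin.castLE hle i) : ℕ) : ℂ) * (((j + 1) * d (Fin.castLE hle₁ (Fin.last j)) : ℕ) : ℂ) := by
    rw [content_succ₅₁ d hle hle₁]
    push_cast
    ring
  have h1 := wedgePow_succ_eq_wedge_left (ofRealForm η) j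
  rw [hm, hC, mul_smul, hγ, wedge_smul_right_complex, domDomCongr_finCongr_smul] at h1
  exact (smul_right_injective (E [⋀^Fin (2 * (j + 1))]→L[ℝ] ℂ) (content_ne_zero₅₁ hd hη hle) h1).symm

/-- **`⟨θ, γ_j ∧ ω⟩ = (j+1)·d_{j+1}·⟨γ_{j+1}, ω⟩`** for every form `ω` of degree `l` (`2 + (2j + l) = 2 dim X`, any orientation).
[cite: Lange2023AbelianVarietiesComplex, §2.5.3 Thm. 2.5.16 (PDF p. 135); §6.2.4 (PDF p. 310 L9–L13)] -/
theorem IsPolarizationType.poincarePairing_ofRealForm_wedge_eq_mul {Φ : (ι → ℝ) ≃L[ℝ] E} (hd : IsPolarizationType Φ η d)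
    (hη : IsRiemannForm Φ η) {j : ℕ} (hle : j ≤ g) (hle₁ : j + 1 ≤ g) {γ : E [⋀^Fin (2 * j)]→L[ℝ] ℂ} {m : E [⋀^Fin (2 * (j + 1))]→L[ℝ] ℂ}
    (hγ : wedgePow (ofRealForm η) j = ((j.factorial * ∏ i : Fin j, d (Fin.castLE hle i) : ℕ) : ℂ) • γ)
    (hm : wedgePow (ofRealForm η) (j + 1) = (((j + 1).factorial * ∏ i : Fin (j + 1), d (Fin.castLE hle₁ i) : ℕ) : ℂ) • m)
    (e : Fin n ≃ ι) {l : ℕ} (hn : 2 + (2 * j + l) = n) (hn' : 2 * (j + 1) + l = n) (ω : E [⋀^Fin l]→L[ℝ] ℂ) :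
    poincarePairing Φ e hn (ofRealForm η) (γ.wedge ω) =
      (((j + 1) * d (Fin.castLE hle₁ (Fin.last j)) : ℕ) : ℂ) * poincarePairing Φ e hn' m ω := by
  have hθγ : (ofRealForm η).wedge γ =
      ((((j + 1) * d (Fin.castLE hle₁ (Fin.last j)) : ℕ) : ℂ) • m).domDomCongr (finCongr (Nat.add_comm 2 (2 * j)).symm) := by
    rw [← hd.ofRealForm_wedge_eq_smul_of_eq_content_smul hη hle hle₁ hγ hm, domDomCongr_finCongr_trans, domDomCongr_finCongr_self]
  have hassoc : (ofRealForm η).wedge (γ.wedge ω) =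
      (((ofRealForm η).wedge γ).wedge ω).domDomCongr (finCongr (Nat.add_assoc 2 (2 * j) l)) := by
    rw [ContinuousAlternatingMap.WedgeAssoc_holds ℝ E ℂ (ofRealForm η) γ ω, domDomCongr_finCongr_trans, domDomCongr_finCongr_self]
  rw [poincarePairing_apply, poincarePairing_apply, hassoc, hθγ, domDomCongr_finCongr_wedge, domDomCongr_finCongr_trans,
    wedge_smul_left_complex, domDomCongr_finCongr_smul, ContinuousAlternatingMap.smul_apply, smul_eq_mul]
  rfl

/-! ## §2 The value groups of the `θ`-functional: `φ(H^{k}(X, ℤ)) = d₁ℤ` and `φ(γ_j ∧ Hˡ(X, ℤ)) = (j+1)·d_{j+1}·ℤ` -/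

/-- **`⟨θ, H^{2g−2}(X, ℤ)⟩ = d₁ℤ`, and generally `φ(Hˡ(X, ℤ)) = d₁ℤ` for the `θ`-functional `φ = ⟨θ, ·⟩_e`** (`2 + l = 2 dim X`): `θ = d₁·γ₁`
with `γ₁` integral and unimodular (g41-#9). [cite: Lange2023AbelianVarietiesComplex, §2.5.3 Cor. 2.5.17 (PDF p. 135); §6.2.4 (PDF p. 310 L9–L13); §1.5.1 (PDF p. 51)] -/
theorem IsPolarizationType.map_poincarePairing_ofRealForm_eq_zmultiples {Φ : (ι → ℝ) ≃L[ℝ] E} (hd : IsPolarizationType Φ η d)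
    (hη : IsRiemannForm Φ η) (h1 : 1 ≤ g) (e : Fin n ≃ ι) {l : ℕ} (hn : 2 + l = n) :
    (integralForms Φ l).map (poincarePairing Φ e hn (ofRealForm η)).toAddMonoidHom =
      AddSubgroup.zmultiples ((d (Fin.castLE h1 0) : ℕ) : ℂ) := by
  obtain ⟨γ₁, hγ₁Z, hγ₁⟩ := hd.exists_mem_integralForms_wedgePow_eq_content_smul h1
  have hc : ((Nat.factorial 1 * ∏ i : Fin 1, d (Fin.castLE h1 i) : ℕ) : ℂ) = ((d (Fin.castLE h1 0) : ℕ) : ℂ) := by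
    rw [Nat.factorial_one, one_mul, Fin.prod_univ_one]
  have hθ : ofRealForm η = ((d (Fin.castLE h1 0) : ℕ) : ℂ) • γ₁ := by
    rw [← hc, ← hγ₁, wedgePow_one_eq_self₅₁]
  have hval : ∀ y, poincarePairing Φ e hn (ofRealForm η) y = ((d (Fin.castLE h1 0) : ℕ) : ℂ) * poincarePairing Φ e hn γ₁ y :=
    fun y ↦ by rw [hθ, map_smul, LinearMap.smul_apply, smul_eq_mul]
  ext z
  constructor
  · rintro ⟨y, hy, rfl⟩
    obtain ⟨c, hc'⟩ := poincarePairing_mem_range_int Φ e hn hγ₁Z hy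
    refine AddSubgroup.mem_zmultiples_iff.2 ⟨c, ?_⟩
    rw [LinearMap.toAddMonoidHom_coe, hval, hc', zsmul_eq_mul, mul_comm]
  · intro hz
    obtain ⟨c, rfl⟩ := AddSubgroup.mem_zmultiples_iff.1 hz
    obtain ⟨y₁, hy₁Z, hy₁⟩ := hd.exists_poincarePairing_eq_one_of_wedgePow_eq_content_smul hη h1 hγ₁Z hγ₁ e hn
    refine ⟨(c : ℂ) • y₁, intCast_smul_mem_integralForms Φ hy₁Z c, ?_⟩
    rw [LinearMap.toAddMonoidHom_coe, hval, map_smul, hy₁, smul_eq_mul, mul_one, zsmul_eq_mul, mul_comm]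

/-- **`φ(γ_j ∧ Hˡ(X, ℤ)) = (j+1)·d_{j+1}·ℤ`**: the `θ`-functional on the Lefschetz image of the minimal class `γ_j` takes exactly the multiples of
`(j+1)·d_{j+1}` (`⟨θ, γ_j ∧ ω⟩ = (j+1)·d_{j+1}·⟨γ_{j+1}, ω⟩`, `γ_{j+1}` unimodular). [cite: Lange2023AbelianVarietiesComplex, §2.5.3 Thm. 2.5.16 and Cor. 2.5.17 (PDF p. 135); §6.2.4 (PDF p. 310 L9–L13)] [cite: BenoistDebarre2023SmoothSubvarietiesJacobians, §1 (p. 3)] -/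
theorem IsPolarizationType.map_map_wedge_poincarePairing_ofRealForm_eq_zmultiples {Φ : (ι → ℝ) ≃L[ℝ] E} (hd : IsPolarizationType Φ η d)
    (hη : IsRiemannForm Φ η) {j : ℕ} (hle : j ≤ g) (hle₁ : j + 1 ≤ g) {γ : E [⋀^Fin (2 * j)]→L[ℝ] ℂ}
    (hγ : wedgePow (ofRealForm η) j = ((j.factorial * ∏ i : Fin j, d (Fin.castLE hle i) : ℕ) : ℂ) • γ)
    (e : Fin n ≃ ι) {l : ℕ} (hn : 2 + (2 * j + l) = n) :
    ((integralForms Φ l).map (AddMonoidHom.mk' (fun ω : E [⋀^Fin l]→L[ℝ] ℂ ↦ γ.wedge ω) (ContinuousAlternatingMap.wedge_add_right _))).map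
        (poincarePairing Φ e hn (ofRealForm η)).toAddMonoidHom =
      AddSubgroup.zmultiples ((((j + 1) * d (Fin.castLE hle₁ (Fin.last j))) : ℕ) : ℂ) := by
  obtain ⟨m, hmZ, hm⟩ := hd.exists_mem_integralForms_wedgePow_eq_content_smul hle₁
  have hn' : 2 * (j + 1) + l = n := by omega
  have hval : ∀ ω, poincarePairing Φ e hn (ofRealForm η) (γ.wedge ω) =
      (((j + 1) * d (Fin.castLE hle₁ (Fin.last j)) : ℕ) : ℂ) * poincarePairing Φ e hn' m ω :=
    hd.poincarePairing_ofRealForm_wedge_eq_mul hη hle hle₁ hγ hm e hn hn'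
  ext z
  constructor
  · rintro ⟨_, ⟨ω, hω, rfl⟩, rfl⟩
    obtain ⟨c, hc⟩ := poincarePairing_mem_range_int Φ e hn' hmZ hω
    refine AddSubgroup.mem_zmultiples_iff.2 ⟨c, ?_⟩
    rw [LinearMap.toAddMonoidHom_coe, AddMonoidHom.mk'_apply, hval, hc, zsmul_eq_mul, mul_comm]
  · intro hz
    obtain ⟨c, rfl⟩ := AddSubgroup.mem_zmultiples_iff.1 hz
    obtain ⟨ω₁, hω₁Z, hω₁⟩ := hd.exists_poincarePairing_eq_one_of_wedgePow_eq_content_smul hη hle₁ hmZ hm e hn'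
    refine ⟨_, ⟨(c : ℂ) • ω₁, intCast_smul_mem_integralForms Φ hω₁Z c, rfl⟩, ?_⟩
    rw [LinearMap.toAddMonoidHom_coe, AddMonoidHom.mk'_apply, hval, map_smul, hω₁, smul_eq_mul, mul_one, zsmul_eq_mul, mul_comm]

/-! ## §3 The index `[H^{2j+l}(X, ℤ) : γ_j ∧ Hˡ(X, ℤ) + K_θ] = (j+1)·d_{j+1}/d₁` -/

/-- **`[H^{2j+l}(X, ℤ) : γ_j ∧ Hˡ(X, ℤ) + K_θ] = (j+1)·d_{j+1}/d₁`** for the kernel `K_θ` of the `θ`-functional `φ = ⟨θ, ·⟩_e` on `H^{2j+l}(X, ℂ)`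
(any presentation of a polarised torus of type `(d₁, …, d_g)`, `j + 1 ≤ g`, `2 + 2j + l = 2 dim X`, any orientation): `H/(S + K_θ ∩ H) ≅ φ(H)/φ(S) =
d₁ℤ/((j+1)d_{j+1}ℤ)` by §2. [cite: Lange2023AbelianVarietiesComplex, §5.4.1 Thm. 5.4.1 and (5.22) (PDF p. 275); §2.5.3 Cor. 2.5.17 (PDF p. 135); §6.2.4 (PDF p. 310 L9–L13); §1.5.1 (PDF p. 51)] [cite: VoisinHodgeI2002, §6.2.3 Thm. 6.25 (PDF p. 125); §7.1.2 (PDF p. 134 L31)] -/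
theorem IsPolarizationType.relIndex_map_wedge_sup_ker_poincarePairing_ofRealForm {Φ : (ι → ℝ) ≃L[ℝ] E} (hd : IsPolarizationType Φ η d)
    (hη : IsRiemannForm Φ η) {j : ℕ} (hle : j ≤ g) (hle₁ : j + 1 ≤ g) {γ : E [⋀^Fin (2 * j)]→L[ℝ] ℂ}
    (hγ : wedgePow (ofRealForm η) j = ((j.factorial * ∏ i : Fin j, d (Fin.castLE hle i) : ℕ) : ℂ) • γ)
    (e : Fin n ≃ ι) {l : ℕ} (hn : 2 + (2 * j + l) = n) :
    ((integralForms Φ l).map (AddMonoidHom.mk' (fun ω : E [⋀^Fin l]→L[ℝ] ℂ ↦ γ.wedge ω) (ContinuousAlternatingMap.wedge_add_right _)) ⊔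
        (poincarePairing Φ e hn (ofRealForm η)).toAddMonoidHom.ker).relIndex (integralForms Φ (2 * j + l)) =
      (j + 1) * d (Fin.castLE hle₁ (Fin.last j)) / d (Fin.castLE hle₁ 0) := by
  have h1 : 1 ≤ g := le_trans (Nat.le_add_left 1 j) hle₁
  have h0 : Fin.castLE h1 0 = Fin.castLE hle₁ 0 := Fin.ext rfl
  rw [← AddSubgroup.comap_map_eq, AddSubgroup.relIndex_comap,
    hd.map_map_wedge_poincarePairing_ofRealForm_eq_zmultiples hη hle hle₁ hγ e hn,
    hd.map_poincarePairing_ofRealForm_eq_zmultiples hη h1 e hn, h0]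
  exact relIndex_zmultiples_natCast₅₁ (hd.pos hη _).ne'
    (Dvd.dvd.mul_left (hd.dvd ((Fin.strictMono_castLE hle₁).monotone (Fin.zero_le _))) _)

end Core

/-! ## §3' Symplectic presentations and the headline `g = j + 2`, `l = 2` -/

section Headline

variable {ι : Type*} [Fintype ι] [DecidableEq ι] {E : Type*} [NormedAddCommGroup E] [NormedSpace ℂ E]
  (Φ : (ι → ℝ) ≃L[ℝ] E) {j n : ℕ} {e₀ : Fin (j + 2) ⊕ Fin (j + 2) ≃ ι} {η : E [⋀^Fin 2]→L[ℝ] ℝ} {d : Fin (j + 2) → ℕ}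

/-- **`[H^{2g−2}(X, ℤ) : γ_{g−2} ∧ H²(X, ℤ) + K_θ] = (g−1)·d_{g−1}/d₁`** (`g = j + 2`, symplectic enumeration of type `(d₁, …, d_g)`, minimal class
`γ_{g−2}`, `K_θ` the kernel of `⟨θ, ·⟩_e` on `H^{2g−2}(X, ℂ)`): of the full cokernel `[H^{2g−2} : γ_{g−2} ∧ H²] = (g−1)·∏_{i≤g−2}((d_{g−1}/d_i)(d_g/d_i))^{…}`
(g40-#6) exactly the factor `(g−1)·d_{g−1}/d₁` is detected by the polarisation; for a principal polarisation `g − 1`.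
[cite: Lange2023AbelianVarietiesComplex, §5.4.1 Thm. 5.4.1 and (5.22) (PDF p. 275); §2.5.3 Cor. 2.5.17 (PDF p. 135); §6.2.4 (PDF p. 310 L9–L13); §1.5.1 (PDF p. 51)] [cite: VoisinHodgeI2002, §6.2.3 Thm. 6.25 (PDF p. 125); §7.1.2 (PDF p. 134 L31)] [cite: BenoistDebarre2023SmoothSubvarietiesJacobians, §1 (p. 3)] -/
theorem IsSymplecticEnum.relIndex_map_wedge_two_sup_ker_eq (h : IsSymplecticEnum Φ e₀ η d) (hη : IsRiemannForm Φ η) (hle : j ≤ j + 2)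
    {γ : E [⋀^Fin (2 * j)]→L[ℝ] ℂ} (hγ : wedgePow (ofRealForm η) j = ((j.factorial * ∏ i : Fin j, d (Fin.castLE hle i) : ℕ) : ℂ) • γ)
    (e : Fin n ≃ ι) (hn : 2 + (2 * j + 2) = n) :
    ((integralForms Φ 2).map (AddMonoidHom.mk' (fun ω : E [⋀^Fin 2]→L[ℝ] ℂ ↦ γ.wedge ω) (ContinuousAlternatingMap.wedge_add_right _)) ⊔
        (poincarePairing Φ e hn (ofRealForm η)).toAddMonoidHom.ker).relIndex (integralForms Φ (2 * j + 2)) =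
      (j + 1) * d (Fin.last j).castSucc / d 0 := by
  have hle₁ : j + 1 ≤ j + 2 := by omega
  have h := h.isPolarizationType.relIndex_map_wedge_sup_ker_poincarePairing_ofRealForm hη hle hle₁ hγ e hn
  have hlast : Fin.castLE hle₁ (Fin.last j) = (Fin.last j).castSucc := Fin.ext rfl
  have hzero : Fin.castLE hle₁ 0 = 0 := Fin.ext rfl
  rwa [hlast, hzero] at h

/-- **Any presentation: `[H^{2g−2}(X, ℤ) : γ_{g−2} ∧ H²(X, ℤ) + K_θ] = (g−1)·d_{g−1}/d₁`** (`g = j + 2`).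
[cite: Lange2023AbelianVarietiesComplex, §5.4.1 Thm. 5.4.1 and (5.22) (PDF p. 275); §1.5.1 (PDF p. 51)] [cite: VoisinHodgeI2002, §7.1.2 (PDF p. 134 L31)] -/
theorem IsPolarizationType.relIndex_map_wedge_two_sup_ker_eq {Φ : (ι → ℝ) ≃L[ℝ] E} (hd : IsPolarizationType Φ η d)
    (hη : IsRiemannForm Φ η) (hle : j ≤ j + 2) {γ : E [⋀^Fin (2 * j)]→L[ℝ] ℂ}
    (hγ : wedgePow (ofRealForm η) j = ((j.factorial * ∏ i : Fin j, d (Fin.castLE hle i) : ℕ) : ℂ) • γ) (e : Fin n ≃ ι) (hn : 2 + (2 * j + 2) = n) :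
    ((integralForms Φ 2).map (AddMonoidHom.mk' (fun ω : E [⋀^Fin 2]→L[ℝ] ℂ ↦ γ.wedge ω) (ContinuousAlternatingMap.wedge_add_right _)) ⊔
        (poincarePairing Φ e hn (ofRealForm η)).toAddMonoidHom.ker).relIndex (integralForms Φ (2 * j + 2)) =
      (j + 1) * d (Fin.last j).castSucc / d 0 := by
  have hle₁ : j + 1 ≤ j + 2 := by omega
  have h := hd.relIndex_map_wedge_sup_ker_poincarePairing_ofRealForm hη hle hle₁ hγ e hn
  have hlast : Fin.castLE hle₁ (Fin.last j) = (Fin.last j).castSucc := Fin.ext rfl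
  have hzero : Fin.castLE hle₁ 0 = 0 := Fin.ext rfl
  rwa [hlast, hzero] at h

/-- **Existence form**: any polarised torus of type `(d₁, …, d_g)` (`g = j + 2`) carries the integral minimal class `γ_{g−2}` with
`[H^{2g−2}(X, ℤ) : γ_{g−2} ∧ H²(X, ℤ) + K_θ] = (g−1)·d_{g−1}/d₁`. [cite: Lange2023AbelianVarietiesComplex, §2.5.3 Thm. 2.5.16 and Cor. 2.5.17 (PDF p. 135); §5.4.1 (5.22) (PDF p. 275); §1.5.1 (PDF p. 51)] -/
theorem IsPolarizationType.exists_minimalClass_relIndex_map_wedge_two_sup_ker_eq {Φ : (ι → ℝ) ≃L[ℝ] E} (hd : IsPolarizationType Φ η d)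
    (hη : IsRiemannForm Φ η) (hle : j ≤ j + 2) (e : Fin n ≃ ι) (hn : 2 + (2 * j + 2) = n) :
    ∃ γ ∈ integralForms Φ (2 * j), wedgePow (ofRealForm η) j = ((j.factorial * ∏ i : Fin j, d (Fin.castLE hle i) : ℕ) : ℂ) • γ ∧
      ((integralForms Φ 2).map (AddMonoidHom.mk' (fun ω : E [⋀^Fin 2]→L[ℝ] ℂ ↦ γ.wedge ω) (ContinuousAlternatingMap.wedge_add_right _)) ⊔
          (poincarePairing Φ e hn (ofRealForm η)).toAddMonoidHom.ker).relIndex (integralForms Φ (2 * j + 2)) =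
        (j + 1) * d (Fin.last j).castSucc / d 0 := by
  obtain ⟨γ, hγZ, hγ⟩ := hd.exists_mem_integralForms_wedgePow_eq_content_smul hle
  exact ⟨γ, hγZ, hγ, hd.relIndex_map_wedge_two_sup_ker_eq hη hle hγ e hn⟩

end Headline


end Literature.Geometry.Kaehler.ComplexTorus
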